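import Summits.ResolutionOfSingularities.ResolutionOfSingularities.Theorems.WildConesCampaignW46HypersurfacesCharTwoThirdPoint
import Mathlib.FieldTheory.IsAlgClosed.Basic

/-!
# [OURS · L1 W4.6, rung (ii) at p = 2, EVERY dimension n] EXACTLY THREE OVER AN ALGEBRAICALLY CLOSED FIELD: a
# corank-two double point of `z² = a(u₁,…,uₙ)` in the three-tangents class `(e, h₂) = (2, 1)` over an algebraically
# closed field of characteristic 2 has EXACTLY THREE infinitely-near double points (all free); every corank-two
# double point has at least one

HONEST FRAMING. Everything here is OURS: theorems about route WildCones' own TYPED point-blow-up dynamics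
(`Theorems/WildConesClassicalRegimesDefs.lean`) and the seat's invariants `polarMatrix` (p502936),
`milnorEmbDim` (p498937), `milnorHilbertTwo` (p511581), `degForm` (p522667). NOTHING here is a statement of the
manuscript [Hironaka2017]; no FACT-LIST premise; AI review is weaker than expert review. Cell res-hironaka
(LADDER-RESOLUTION rung L, D-0089), slot W4.6, seat res-L1-s46-pv-4 (gen 6); host route `WildCones`, crux
`ClassicalRegimes` (stmt-ResolutionOfSingularities-16884; proved).

THE ARGUMENT. The kernel cubic along a line is a polynomial of degree `≤ 3` whose coefficients are the tangent
cubic and the two polars (cubic polarization, p543928). (1) A NEAR POINT EXISTS at corank two over an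
algebraically closed field: with a kernel basis `v₁, v₂`, either `a₃(v₁) = 0`, or `x ↦ a₃(v₂ + xv₁)` has degree
exactly `3` and a root. (2) A SECOND ONE next to a FREE near point `w₁`: along `x ↦ a₃(v + xw₁)` the cubic term
vanishes (`a₃(w₁) = 0`) and the quadratic coefficient is `polar(v, w₁) ≠ 0` (freeness), so a root `x₀` exists and
`w₂ = v + x₀w₁` is a near point off the line of `w₁`. (3) At `h₂ = 1` all near points are free (gen 4), so (1), (2)
and TWO FREE POINTS GIVE A THIRD (p555329) produce three pairwise distinct near double points; the census (p543928)
says there are no more: EXACTLY THREE — the `D₄` configuration, as over the complex numbers.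

WHAT IS PROVED (every `n`; `κ` algebraically closed of characteristic `2` where marked):

* `hypersurface_exists_near_of_isAlgClosed` — alg. closed, `e = 2`: a non-zero kernel vector on the tangent cubic
  exists; `hypersurface_exists_double_successor_of_isAlgClosed` — (isolated) hence a double successor exists;
* `hypersurface_exists_second_near_of_free` — alg. closed, `e = 2`, a free near vector `w₁` ⇒ a near vector off
  its line;
* `hypersurface_three_near_points_of_isAlgClosed` — **alg. closed, isolated `(e, h₂) = (2, 1)` ⇒ THREE double
  successors of corank `0` with pairwise non-proportional near vectors** (with p543928: exactly three).

References: [CasasAlvero2000] §3 (context only); [GreuelPfister2026] (context); [Hironaka2017] Th. 16.6 p.84 —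
role replaced only, under adjudication; nothing of it is used.
-/

noncomputable section

-- single-problem summit: the doubled namespace component `ResolutionOfSingularities` is forced
set_option linter.dupNamespace false

open scoped BigOperators Classical

open MvPowerSeries IsLocalRing

open Literature.AlgebraicGeometry.Resolution

namespace Summit.ResolutionOfSingularities.ResolutionOfSingularities.Theorems

namespace CampaignW46.HypersurfacesCharTwo

open WildCones WildCones.MuDropCharTwoOrdP ThreefoldsCharTwo

variable {κ : Type} [Field κ] {n : ℕ}

/-! ## A near point exists over an algebraically closed field -/

/-- [OURS · L1 W4.6] In corank two a non-zero kernel vector exists. [folklore] -/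
theorem exists_kernel_ne_zero [CharP κ 2] {c : (Fin n → ℕ) → κ} (hM : MultP 2 n κ c) (he : milnorEmbDim 2 n κ c = 2) :
    ∃ v : Fin n → κ, v ≠ 0 ∧ Matrix.vecMul v (polarMatrix (ser 2 n κ c)) = 0 := by
  set K := LinearMap.ker (polarMatrix (ser 2 n κ c)).mulVecLin with hK
  have hfr : Module.finrank κ K = 2 := by rw [hK, finrank_ker_polarMatrix hM, he]
  have hne : K ≠ ⊥ := by
    intro h
    rw [h, finrank_bot] at hfr
    exact absurd hfr (by norm_num)
  obtain ⟨v, hvK, hv0⟩ := Submodule.exists_mem_ne_zero_of_ne_bot hne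
  exact ⟨v, hv0, (mem_ker_polarMatrix_iff _ _).mp hvK⟩

/-- [OURS · L1 W4.6 rung (ii) at `p = 2`, every dimension, ALGEBRAICALLY CLOSED field; NOT a statement of the
manuscript] **IN CORANK TWO A NEAR POINT EXISTS over an algebraically closed field of characteristic `2`**: some
non-zero kernel vector of the polar form lies on the tangent cubic (with a kernel basis `v₁, v₂`: `[v₁]` if
`a₃(v₁) = 0`, else a root of the cubic `x ↦ a₃(v₂ + xv₁)`). [folklore] -/
theorem hypersurface_exists_near_of_isAlgClosed [CharP κ 2] [IsAlgClosed κ] (c : (Fin n → ℕ) → κ)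
    (hM : MultP 2 n κ c) (he : milnorEmbDim 2 n κ c = 2) :
    ∃ w : Fin n → κ, w ≠ 0 ∧ Matrix.vecMul w (polarMatrix (ser 2 n κ c)) = 0 ∧ degForm 3 (ser 2 n κ c) w = 0 := by
  set f := ser 2 n κ c with hfdef
  obtain ⟨v₁, hv₁0, hv₁⟩ := exists_kernel_ne_zero hM he
  by_cases ha : degForm 3 f v₁ = 0
  · exact ⟨v₁, hv₁0, hv₁, ha⟩
  obtain ⟨v₂, hv₂, hnot, -⟩ := exists_kernel_pair hM he hv₁0 hv₁
  -- the cubic along `x ↦ v₂ + x v₁`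
  set P : Polynomial κ := Polynomial.C (degForm 3 f v₁) * Polynomial.X ^ 3 +
    Polynomial.C (∑ s, v₂ s * degForm 2 (MvPowerSeries.pderiv s f) v₁) * Polynomial.X ^ 2 +
    Polynomial.C (∑ s, v₁ s * degForm 2 (MvPowerSeries.pderiv s f) v₂) * Polynomial.X +
    Polynomial.C (degForm 3 f v₂) with hP
  have hdeg : P.degree ≠ 0 := by rw [hP, Polynomial.degree_cubic ha]; decide
  obtain ⟨x₀, hx₀⟩ := IsAlgClosed.exists_root P hdeg
  have heval : degForm 3 f (v₂ + x₀ • v₁) = 0 := by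
    rw [degForm_three_add_smul]
    rw [Polynomial.IsRoot.def, hP] at hx₀
    simp only [Polynomial.eval_add, Polynomial.eval_mul, Polynomial.eval_C, Polynomial.eval_pow,
      Polynomial.eval_X] at hx₀
    linear_combination hx₀
  refine ⟨v₂ + x₀ • v₁, fun h0 => hnot (-x₀) ?_, ?_, heval⟩
  · rw [neg_smul]
    exact eq_neg_of_add_eq_zero_left h0
  · rw [Matrix.add_vecMul, Matrix.smul_vecMul, hv₁, hv₂, smul_zero, add_zero]

/-- [OURS · L1 W4.6 rung (ii) at `p = 2`, every dimension, algebraically closed field; NOT a statement of the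
manuscript] Hence an ISOLATED corank-two double point over an algebraically closed field of characteristic `2`
always HAS an infinitely-near double point. [folklore] -/
theorem hypersurface_exists_double_successor_of_isAlgClosed [CharP κ 2] [IsAlgClosed κ] (c : (Fin n → ℕ) → κ)
    (hM : MultP 2 n κ c) (hI : Isol 2 n κ c) (he : milnorEmbDim 2 n κ c = 2) :
    ∃ (i : Fin n) (τ : Fin n → κ), MultP 2 n κ (step 2 n κ i τ c) := by
  obtain ⟨w, hw0, hw, hcub⟩ := hypersurface_exists_near_of_isAlgClosed c hM he
  exact hypersurface_exists_double_successor_of_kernel_root c hM hI hw0 hw hcub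

/-! ## A second near point next to a free one -/

/-- [OURS · L1 W4.6 rung (ii) at `p = 2`, every dimension, ALGEBRAICALLY CLOSED field; NOT a statement of the
manuscript] **NEXT TO A FREE NEAR POINT THERE IS A SECOND NEAR POINT** (corank two, algebraically closed field of
characteristic `2`): if `w₁ ≠ 0` is a kernel vector on the tangent cubic at which some kernel polar is non-zero,
then some kernel vector on the cubic is NOT a multiple of `w₁` — along `x ↦ a₃(v + xw₁)` the cubic coefficient
`a₃(w₁)` vanishes and the quadratic one, `polar(v, w₁)`, does not. [folklore] -/
theorem hypersurface_exists_second_near_of_free [CharP κ 2] [IsAlgClosed κ] (c : (Fin n → ℕ) → κ)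
    (hM : MultP 2 n κ c) (he : milnorEmbDim 2 n κ c = 2) {w₁ : Fin n → κ} (hw₁0 : w₁ ≠ 0)
    (hw₁ : Matrix.vecMul w₁ (polarMatrix (ser 2 n κ c)) = 0) (hc₁ : degForm 3 (ser 2 n κ c) w₁ = 0)
    (hf₁ : ∃ v : Fin n → κ, Matrix.vecMul v (polarMatrix (ser 2 n κ c)) = 0 ∧
      ∑ s, v s * degForm 2 (MvPowerSeries.pderiv s (ser 2 n κ c)) w₁ ≠ 0) :
    ∃ w₂ : Fin n → κ, Matrix.vecMul w₂ (polarMatrix (ser 2 n κ c)) = 0 ∧ degForm 3 (ser 2 n κ c) w₂ = 0 ∧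
      ∀ r : κ, w₂ ≠ r • w₁ := by
  set f := ser 2 n κ c with hfdef
  obtain ⟨v, hv, hnot, -⟩ := exists_kernel_pair hM he hw₁0 hw₁
  -- the quadratic coefficient `polar(v, w₁)` is non-zero
  have hd₁ : ∑ s, w₁ s * degForm 2 (MvPowerSeries.pderiv s f) w₁ = 0 := by
    rw [← degForm_three_eq_polar_self]; exact hc₁
  have hm : ∑ s, v s * degForm 2 (MvPowerSeries.pderiv s f) w₁ ≠ 0 := by
    obtain ⟨u, hu, hne⟩ := hf₁
    obtain ⟨α, β, hαβ⟩ := kernel_span_pair hM he hw₁0 hw₁ hv hnot u hu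
    rw [← hαβ, polar_add_smul, hd₁, mul_zero, zero_add] at hne
    exact fun h0 => hne (by rw [h0, mul_zero])
  -- the cubic along `x ↦ v + x w₁` is a genuine quadratic
  set P : Polynomial κ := Polynomial.C (∑ s, v s * degForm 2 (MvPowerSeries.pderiv s f) w₁) * Polynomial.X ^ 2 +
    Polynomial.C (∑ s, w₁ s * degForm 2 (MvPowerSeries.pderiv s f) v) * Polynomial.X +
    Polynomial.C (degForm 3 f v) with hP
  have hdeg : P.degree ≠ 0 := by rw [hP, Polynomial.degree_quadratic hm]; decide
  obtain ⟨x₀, hx₀⟩ := IsAlgClosed.exists_root P hdeg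
  have heval : degForm 3 f (v + x₀ • w₁) = 0 := by
    rw [degForm_three_add_smul, hc₁, mul_zero, add_zero]
    rw [Polynomial.IsRoot.def, hP] at hx₀
    simp only [Polynomial.eval_add, Polynomial.eval_mul, Polynomial.eval_C, Polynomial.eval_pow,
      Polynomial.eval_X] at hx₀
    linear_combination hx₀
  refine ⟨v + x₀ • w₁, ?_, heval, fun r h => hnot (r - x₀) ?_⟩
  · rw [Matrix.add_vecMul, Matrix.smul_vecMul, hw₁, hv, smul_zero, add_zero]
  · rw [sub_smul, ← h, add_sub_cancel_right]

/-! ## Exactly three at `h₂ = 1` -/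

/-- [OURS · L1 W4.6 rung (ii) at `p = 2`, EVERY dimension `n`, ALGEBRAICALLY CLOSED field of characteristic `2`;
NOT a statement of the manuscript] **THE THREE-TANGENTS CLASS HAS EXACTLY THREE INFINITELY-NEAR DOUBLE POINTS over
an algebraically closed field**: an isolated double state of `z² = a(u₁,…,uₙ)` with `e(c) = 2`, `h₂(c) = 1` has
three charts/translations giving double successors of corank `0` (free: isolated, `μ = 1`, nothing after) whose
near vectors are pairwise non-proportional; by the census (p543928) every near vector is a multiple of one of
them. (A near point exists; at `h₂ = 1` it is free, gen 4; next to a free point there is a second; two free points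
give a third, p555329.) [folklore] -/
theorem hypersurface_three_near_points_of_isAlgClosed [CharP κ 2] [IsAlgClosed κ] (c : (Fin n → ℕ) → κ)
    (hM : MultP 2 n κ c) (hI : Isol 2 n κ c) (he : milnorEmbDim 2 n κ c = 2) (hh : milnorHilbertTwo 2 n κ c = 1) :
    ∃ (i₁ i₂ i₃ : Fin n) (τ₁ τ₂ τ₃ : Fin n → κ),
      (MultP 2 n κ (step 2 n κ i₁ τ₁ c) ∧ milnorEmbDim 2 n κ (step 2 n κ i₁ τ₁ c) = 0) ∧
      (MultP 2 n κ (step 2 n κ i₂ τ₂ c) ∧ milnorEmbDim 2 n κ (step 2 n κ i₂ τ₂ c) = 0) ∧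
      (MultP 2 n κ (step 2 n κ i₃ τ₃ c) ∧ milnorEmbDim 2 n κ (step 2 n κ i₃ τ₃ c) = 0) ∧
      (∀ r : κ, Function.update τ₂ i₂ 1 ≠ r • Function.update τ₁ i₁ 1) ∧
      (∀ r : κ, Function.update τ₃ i₃ 1 ≠ r • Function.update τ₁ i₁ 1) ∧
      (∀ r : κ, Function.update τ₃ i₃ 1 ≠ r • Function.update τ₂ i₂ 1) := by
  -- every double successor is free at `h₂ = 1`
  have hfree : ∀ (i : Fin n) (τ : Fin n → κ), MultP 2 n κ (step 2 n κ i τ c) →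
      milnorEmbDim 2 n κ (step 2 n κ i τ c) = 0 :=
    fun i τ hM' => (hypersurface_regime_step_of_milnorHilbertTwo_eq_one c i τ hM he hh hM').1
  -- a first near point
  obtain ⟨w₁, hw₁0, hk₁, hc₁⟩ := hypersurface_exists_near_of_isAlgClosed c hM he
  obtain ⟨i₁, hi₁⟩ : ∃ i, w₁ i ≠ 0 := by
    by_contra h
    push Not at h
    exact hw₁0 (funext h)
  have hM₁ := hypersurface_multP_step_of_vec c hM hI hi₁ hk₁ hc₁
  have he₁ := hfree i₁ _ hM₁
  -- it is free, as a vector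
  have hf₁ : ∃ v : Fin n → κ, Matrix.vecMul v (polarMatrix (ser 2 n κ c)) = 0 ∧
      ∑ s, v s * degForm 2 (MvPowerSeries.pderiv s (ser 2 n κ c)) w₁ ≠ 0 := by
    obtain ⟨v, hv, hne⟩ := (hypersurface_milnorEmbDim_step_eq_zero_iff c i₁ _ hM he hM₁).mp he₁
    rw [update_inv_smul_eq hi₁, polar_smul_right] at hne
    exact ⟨v, hv, fun h0 => hne (by rw [h0, mul_zero])⟩
  -- a second near point, off the line of the first
  obtain ⟨w₂, hk₂, hc₂, hnot⟩ := hypersurface_exists_second_near_of_free c hM he hw₁0 hk₁ hc₁ hf₁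
  have hw₂0 : w₂ ≠ 0 := fun h0 => hnot 0 (by rw [h0, zero_smul])
  obtain ⟨i₂, hi₂⟩ : ∃ i, w₂ i ≠ 0 := by
    by_contra h
    push Not at h
    exact hw₂0 (funext h)
  have hM₂ := hypersurface_multP_step_of_vec c hM hI hi₂ hk₂ hc₂
  have he₂ := hfree i₂ _ hM₂
  have hf₂ : ∃ v : Fin n → κ, Matrix.vecMul v (polarMatrix (ser 2 n κ c)) = 0 ∧
      ∑ s, v s * degForm 2 (MvPowerSeries.pderiv s (ser 2 n κ c)) w₂ ≠ 0 := by
    obtain ⟨v, hv, hne⟩ := (hypersurface_milnorEmbDim_step_eq_zero_iff c i₂ _ hM he hM₂).mp he₂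
    rw [update_inv_smul_eq hi₂, polar_smul_right] at hne
    exact ⟨v, hv, fun h0 => hne (by rw [h0, mul_zero])⟩
  -- the third
  obtain ⟨i₃, τ₃, hM₃, he₃, hn₁, hn₂⟩ :=
    hypersurface_third_free_point c hM hI he hw₁0 hk₁ hk₂ hnot hc₁ hc₂ hf₁ hf₂
  refine ⟨i₁, i₂, i₃, (w₁ i₁)⁻¹ • w₁, (w₂ i₂)⁻¹ • w₂, τ₃, ⟨hM₁, he₁⟩, ⟨hM₂, he₂⟩, ⟨hM₃, he₃⟩, ?_, ?_, ?_⟩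
  · intro r h
    rw [update_inv_smul_eq hi₁, update_inv_smul_eq hi₂, smul_smul] at h
    apply hnot (w₂ i₂ * (r * (w₁ i₁)⁻¹))
    have := congrArg (fun z => w₂ i₂ • z) h
    simp only [smul_smul, mul_inv_cancel₀ hi₂, one_smul] at this
    exact this
  · intro r h
    rw [update_inv_smul_eq hi₁, smul_smul] at h
    exact hn₁ _ h
  · intro r h
    rw [update_inv_smul_eq hi₂, smul_smul] at h
    exact hn₂ _ h

end CampaignW46.HypersurfacesCharTwo

end Summit.ResolutionOfSingularities.ResolutionOfSingularities.Theorems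

end
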